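import Literature.Probability.RandomPlanarGeometry.SLETwoPointItoProofs
import Literature.Probability.RandomPlanarGeometry.SLELogDerivMartingale
import HarnessLib

/-!
# Lawler's two-point ratio for two boundary points on the same side: the stopped martingale

Trunk T-STOCH. Stochastic layer (Itô step) of the **same-side two-point problem** of the real SLE_κ
flow — two boundary points `0 < y < x`, the weak form of S. Rohde, O. Schramm, *Basic properties
of SLE*, Ann. of Math. 161 (2005), Lemma 6.6 ("intervals swallowed at once") needed for
Lemma 7.3. For the frozen real flows `X = sleRealFlowStop κ x`, `Y = sleRealFlowStop κ y`
(`dX = (2/X) dt - √κ dB`, `dY = (2/Y) dt - √κ dB`), Lawler's ratio `Z = X/(X - Y)`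
(*Conformally Invariant Processes in the Plane* (2005), proof of Prop. 6.33) now lives in
`(1, ∞)`; the gap `X - Y = (x - y) + ∫ (2/X - 2/Y) ds` is still of finite variation, the product
rule gives the same SDE `dZ = (2/(X-Y)²)(1/Z - 1/(1-Z)) dt - (√κ/(X-Y)) dB`, and for every `C²`
function `f` whose first two derivatives on the visited range have Lawler's shape
`f' = K`, `f'' = K · (-2a/z + 2a/(1-z))`, `a = 2/κ` (the branch `z > 1` of (6.21)), `f(Z)` is a
martingale up to the stopping time. We prove this with the stopping rule adapted to the new
geometry (the gap now DEcreases, so we stop when `Y` leaves `(δ₁, R₁)` or `Z` leaves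
`(1 + δ₀, 1 + R)`):

* `sleSameSideRatio κ x y δ₁ R₁` — the ratio `Z` computed from the flows stopped at the exit time
  `τ` of `Y` from `(δ₁, R₁)` (a continuous adapted process for every path, the gap being positive
  up to `τ < T_y`), and `sleSameSideTime κ x y δ₀ R δ₁ R₁ = τ ∧ (exit of Z from (1+δ₀, 1+R))`;
* `sleSameSide_bounds_of_le` — up to that time: `δ₁ ≤ Y < X ≤ (1+δ₀)R₁/δ₀`, `Z ∈ [1+δ₀, 1+R]`,
  `X - Y ≥ δ₁/(1+R)`;
* `martingale_apply_sameSideRatio_stopped` — **for `f ∈ C²(ℝ)` with `f' = K` and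
  `f'' = K(-2a/z + 2a/(1-z))` on `[1+δ₀, 1+R]`, `f(Z_{t∧ρ})` is a martingale** (`κ > 0`): the
  proof of `martingale_stoppedProcess_sleTwoPointObservable` (`SLETwoPointItoProofs`) transposed —
  `isItoProcess_stoppedProcess_sleRealFlowStop`, `inv_eq_inv_add_timeIntegral`,
  `IsItoProcess.mul_timeIntegral`, `lawler_drift_identity` (verbatim, with `B = 1`),
  `martingale_apply_of_itoDrift_eq_zero`.

* `martingale_apply_sameSideRatio_sub_timeIntegral` — the same for an arbitrary `f ∈ C²(ℝ)`, with
  the Itô drift `sameSideItoDrift κ f (X, Y)` kept as a time integral (used at `κ = 4` for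
  Rohde–Schramm's Lemma 7.2, `SLEKappaFourAvoidance`).

The scale function `f = sameSideH (2/κ)` (`SLESameSideKernel`) and the positivity of the
probability that `[y, x]` is swallowed at once follow in the sequel.

## References

* S. Rohde, O. Schramm, *Basic properties of SLE*, Ann. of Math. 161 (2005), Lemma 6.6 and its
  proof (p. 908), Lemma 7.3.
* G. F. Lawler, *Conformally Invariant Processes in the Plane*, AMS (2005), §6.7, Prop. 6.33 and
  its proof (eq. (6.21), footnote 2); §1.10.
* D. Revuz, M. Yor, *Continuous Martingales and Brownian Motion* (1999), Ch. IV (3.3).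
-/

noncomputable section

open MeasureTheory ProbabilityTheory Filter Set Topology
open scoped NNReal ENNReal

namespace Literature.Probability.RandomPlanarGeometry

open Loewner Literature.Probability.Process Literature.Analysis.FunctionSpaces

variable {κ : ℝ≥0} {x y : ℝ}

/-! ### Same-side pathwise facts for the two frozen flows -/

/-- For `0 < y < x` and `t < T_y`: both flows are alive, `0 < Y_t < X_t`, and the gap in integrated
form `X_t - Y_t = (x - y) + ∫₀ᵗ (2/X_s - 2/Y_s) ds` (the driving function cancels).
[cite: Lawler2005, Prop. 6.33] -/
theorem sleRealFlowStop_sameSide_facts (hy : 0 < y) (hyx : y < x) {ω : ℝ≥0 → ℝ} {t : ℝ≥0}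
    (ht : (t : WithTop ℝ≥0) < swallowingTime (sleDriving κ ω) y) :
    0 < sleRealFlowStop κ y t ω ∧ sleRealFlowStop κ y t ω < sleRealFlowStop κ x t ω ∧
      sleRealFlowStop κ x t ω - sleRealFlowStop κ y t ω = (x - y) +
        ∫ s in (0 : ℝ)..t, (2 / sleRealFlowStop κ x s.toNNReal ω - 2 / sleRealFlowStop κ y s.toNNReal ω) := by
  have hx : 0 < x := hy.trans hyx
  have hW : Continuous (sleDriving κ ω) := continuous_sleDriving κ ω
  have hy0 : sleDriving κ ω 0 < y := by rw [sleDriving_zero]; exact hy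
  have hTx : (t : WithTop ℝ≥0) < swallowingTime (sleDriving κ ω) x :=
    lt_of_lt_of_le ht (swallowingTime_mono_right hW hy0 hyx.le)
  have hx' : x ≠ sleDriving κ ω 0 := by rw [sleDriving_zero]; exact hx.ne'
  have hy' : y ≠ sleDriving κ ω 0 := by rw [sleDriving_zero]; exact hy.ne'
  refine ⟨?_, ?_, ?_⟩
  · rw [sleRealFlowStop_apply, realFlowStop_of_lt ht]; exact realFlow_pos hW hy0 ht
  · rw [sleRealFlowStop_apply, sleRealFlowStop_apply, realFlowStop_of_lt ht, realFlowStop_of_lt hTx,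
      realFlow_apply, realFlow_apply]
    linarith [map_ofReal_re_lt_of_lt hW hy0 hyx ht hTx]
  · have h1 := realFlowStop_eq_sub_add_integral hW hx' hTx
    have h2 := realFlowStop_eq_sub_add_integral hW hy' ht
    have hpos : ∀ s ∈ Icc (0 : ℝ) t, 0 < sleRealFlowStop κ y s.toNNReal ω ∧
        0 < sleRealFlowStop κ x s.toNNReal ω := by
      intro s hs
      have hs' : ((s.toNNReal : ℝ≥0) : WithTop ℝ≥0) < swallowingTime (sleDriving κ ω) y :=
        lt_of_le_of_lt (WithTop.coe_le_coe.2 (Real.toNNReal_le_iff_le_coe.2 hs.2)) ht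
      have hsx : ((s.toNNReal : ℝ≥0) : WithTop ℝ≥0) < swallowingTime (sleDriving κ ω) x :=
        lt_of_lt_of_le hs' (swallowingTime_mono_right hW hy0 hyx.le)
      refine ⟨?_, ?_⟩
      · rw [sleRealFlowStop_apply, realFlowStop_of_lt hs']; exact realFlow_pos hW hy0 hs'
      · rw [sleRealFlowStop_apply, realFlowStop_of_lt hsx]; exact realFlow_pos hW (hy0.trans hyx) hsx
    have hcx : ContinuousOn (fun s : ℝ ↦ 2 / sleRealFlowStop κ x s.toNNReal ω) (Icc 0 t) :=
      continuousOn_const.div (((continuous_sleRealFlowStop hx.ne' ω).comp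
        continuous_real_toNNReal).continuousOn) fun s hs ↦ (hpos s hs).2.ne'
    have hcy : ContinuousOn (fun s : ℝ ↦ 2 / sleRealFlowStop κ y s.toNNReal ω) (Icc 0 t) :=
      continuousOn_const.div (((continuous_sleRealFlowStop hy.ne' ω).comp
        continuous_real_toNNReal).continuousOn) fun s hs ↦ (hpos s hs).1.ne'
    rw [intervalIntegral.integral_sub (hcx.intervalIntegrable_of_Icc t.coe_nonneg)
      (hcy.intervalIntegrable_of_Icc t.coe_nonneg)]
    simp only [sleRealFlowStop_apply] at h1 h2 ⊢
    rw [h1, h2]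
    ring

/-! ### The ratio process and the stopping time -/

/-- **Lawler's ratio `Z = X/(X - Y)` for two points `0 < y < x` on the same side**, computed from
the two frozen flows stopped at the exit time `τ` of `Y` from `(δ₁, R₁)`; it lives in `(1, ∞)`.
Up to `τ` it is `X_t/(X_t - Y_t)`; after `τ` it is frozen. (The stopping makes the denominator
positive at all times for every path, so that the process is continuous and adapted without
exception.) [cite: Lawler2005, Prop. 6.33] -/
def sleSameSideRatio (κ : ℝ≥0) (x y δ₁ R₁ : ℝ) (t : ℝ≥0) (ω : ℝ≥0 → ℝ) : ℝ :=
  stoppedProcess (sleRealFlowStop κ x) (exitTime (sleRealFlowStop κ y) δ₁ R₁) t ω /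
    (stoppedProcess (sleRealFlowStop κ x) (exitTime (sleRealFlowStop κ y) δ₁ R₁) t ω -
      stoppedProcess (sleRealFlowStop κ y) (exitTime (sleRealFlowStop κ y) δ₁ R₁) t ω)

/-- **The same-side stopping time** `ρ = τ ∧ ρ_Z`: the first exit of `Y` from `(δ₁, R₁)` or of
the ratio `Z` from `(1 + δ₀, 1 + R)`. [cite: Lawler2005, Prop. 6.33] -/
def sleSameSideTime (κ : ℝ≥0) (x y δ₀ R δ₁ R₁ : ℝ) (ω : ℝ≥0 → ℝ) : WithTop ℝ≥0 :=
  min (exitTime (sleRealFlowStop κ y) δ₁ R₁ ω)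
    (exitTime (sleSameSideRatio κ x y δ₁ R₁) (1 + δ₀) (1 + R) ω)

section Facts

variable (hy : 0 < y) (hyx : y < x) {δ₀ R δ₁ R₁ : ℝ} (hδ₀ : 0 < δ₀) (hz₀ : 1 + δ₀ < x / (x - y))
  (hz₀' : x / (x - y) < 1 + R) (hδ₁ : 0 < δ₁) (hδ₁y : δ₁ < y) (hyR₁ : y < R₁)
include hy hyx hδ₁ hδ₁y hyR₁

/-- Up to the exit time `τ` of `Y` from `(δ₁, R₁)`: `t < T_y`, `δ₁ ≤ Y_t ≤ R₁` and `Y_t < X_t`.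
[folklore] -/
theorem sleRealFlowStop_facts_of_le_exitTime {ω : ℝ≥0 → ℝ} {t : ℝ≥0}
    (ht : (t : WithTop ℝ≥0) ≤ exitTime (sleRealFlowStop κ y) δ₁ R₁ ω) :
    (t : WithTop ℝ≥0) < swallowingTime (sleDriving κ ω) y ∧
      sleRealFlowStop κ y t ω ∈ Icc δ₁ R₁ ∧ sleRealFlowStop κ y t ω < sleRealFlowStop κ x t ω := by
  have hYmem := sleRealFlowStop_mem_Icc_of_le hy hδ₁y hyR₁ le_rfl ht
  have hT : (t : WithTop ℝ≥0) < swallowingTime (sleDriving κ ω) y :=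
    coe_lt_swallowingTime_of_realFlowStop_ne_zero (W := sleDriving κ ω)
      (by rw [← sleRealFlowStop_apply]; exact (hδ₁.trans_le hYmem.1).ne')
  exact ⟨hT, hYmem, (sleRealFlowStop_sameSide_facts hy hyx hT).2.1⟩

/-- The ratio process has continuous paths (every `ω`). [folklore] -/
theorem continuous_sleSameSideRatio (ω : ℝ≥0 → ℝ) : Continuous fun t ↦ sleSameSideRatio κ x y δ₁ R₁ t ω := by
  have hx : 0 < x := hy.trans hyx
  have hVc := continuous_stoppedProcess_apply (continuous_sleRealFlowStop (κ := κ) hx.ne' ω)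
    (exitTime (sleRealFlowStop κ y) δ₁ R₁)
  have hUc := continuous_stoppedProcess_apply (continuous_sleRealFlowStop (κ := κ) hy.ne' ω)
    (exitTime (sleRealFlowStop κ y) δ₁ R₁)
  refine hVc.div (hVc.sub hUc) fun t ↦ ?_
  have h := (sleRealFlowStop_facts_of_le_exitTime hy hyx hδ₁ hδ₁y hyR₁
    (coe_untopA_min_le t (exitTime (sleRealFlowStop κ y) δ₁ R₁ ω))).2.2
  simp only [stoppedProcess]
  linarith

omit hδ₁ hδ₁y hyR₁ in
/-- The ratio process is adapted to the raw Brownian filtration. [folklore] -/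
theorem adapted_sleSameSideRatio : Adapted brownianFiltration (sleSameSideRatio κ x y δ₁ R₁) := by
  have hx : 0 < x := hy.trans hyx
  have hτ := isStoppingTime_exitTime_sleRealFlowStop κ hy δ₁ R₁
  have hVa := (isStronglyProgressive_sleRealFlowStop κ hx.ne').stronglyAdapted_stoppedProcess hτ
  have hUa := (isStronglyProgressive_sleRealFlowStop κ hy.ne').stronglyAdapted_stoppedProcess hτ
  intro t
  exact (hVa t).measurable.div ((hVa t).measurable.sub (hUa t).measurable)

/-- The same-side stopping time is a stopping time. [folklore] -/
theorem isStoppingTime_sleSameSideTime (δ₀ R : ℝ) :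
    IsStoppingTime brownianFiltration (sleSameSideTime κ x y δ₀ R δ₁ R₁) :=
  (isStoppingTime_exitTime_sleRealFlowStop κ hy δ₁ R₁).min
    (isStoppingTime_exitTime (adapted_sleSameSideRatio hy hyx)
      (continuous_sleSameSideRatio hy hyx hδ₁ hδ₁y hyR₁))

include hδ₀ hz₀ hz₀' in
/-- **Bounds up to the same-side stopping time**: for `t ≤ ρ`, `t < T_y`, `δ₁ ≤ Y_t < X_t`,
`Z_t = X_t/(X_t - Y_t) ∈ [1 + δ₀, 1 + R]`, hence `X_t ≤ (1+δ₀) R₁/δ₀` and `X_t - Y_t ≥ δ₁/(1+R)`.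
[cite: Lawler2005, Prop. 6.33] -/
theorem sleSameSide_bounds_of_le {ω : ℝ≥0 → ℝ} {t : ℝ≥0}
    (ht : (t : WithTop ℝ≥0) ≤ sleSameSideTime κ x y δ₀ R δ₁ R₁ ω) :
    (t : WithTop ℝ≥0) < swallowingTime (sleDriving κ ω) y ∧
      δ₁ ≤ sleRealFlowStop κ y t ω ∧ sleRealFlowStop κ y t ω < sleRealFlowStop κ x t ω ∧
      sleRealFlowStop κ x t ω / (sleRealFlowStop κ x t ω - sleRealFlowStop κ y t ω) ∈ Icc (1 + δ₀) (1 + R) ∧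
      sleRealFlowStop κ x t ω ≤ (1 + δ₀) * R₁ / δ₀ ∧
      δ₁ / (1 + R) ≤ sleRealFlowStop κ x t ω - sleRealFlowStop κ y t ω := by
  have hx : 0 < x := hy.trans hyx
  have htτ : (t : WithTop ℝ≥0) ≤ exitTime (sleRealFlowStop κ y) δ₁ R₁ ω := ht.trans (min_le_left _ _)
  have htZ : (t : WithTop ℝ≥0) ≤ exitTime (sleSameSideRatio κ x y δ₁ R₁) (1 + δ₀) (1 + R) ω :=
    ht.trans (min_le_right _ _)
  obtain ⟨hT, hYmem, hYX⟩ := sleRealFlowStop_facts_of_le_exitTime hy hyx hδ₁ hδ₁y hyR₁ htτ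
  -- the ratio at time `t` is the ratio process, which has not left `[1+δ₀, 1+R]`
  have hZ0 : sleSameSideRatio κ x y δ₁ R₁ 0 ω ∈ Ioo (1 + δ₀) (1 + R) := by
    simp only [sleSameSideRatio, stoppedProcess, untopA_min_zero, sleRealFlowStop_zero_apply hx.ne',
      sleRealFlowStop_zero_apply hy.ne']
    exact ⟨hz₀, hz₀'⟩
  have hZmem := stoppedProcess_mem_Icc_of_le_exitTime (continuous_sleSameSideRatio hy hyx hδ₁ hδ₁y hyR₁ ω)
    hZ0 le_rfl t
  rw [stoppedProcess_eq_of_le htZ] at hZmem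
  have hZeq : sleSameSideRatio κ x y δ₁ R₁ t ω =
      sleRealFlowStop κ x t ω / (sleRealFlowStop κ x t ω - sleRealFlowStop κ y t ω) := by
    simp only [sleSameSideRatio, stoppedProcess_eq_of_le htτ]
  rw [hZeq] at hZmem
  set X := sleRealFlowStop κ x t ω
  set Y := sleRealFlowStop κ y t ω
  have hD : 0 < X - Y := sub_pos.2 hYX
  have hYpos : 0 < Y := hδ₁.trans_le hYmem.1
  refine ⟨hT, hYmem.1, hYX, hZmem, ?_, ?_⟩
  · -- `X/(X-Y) ≥ 1+δ₀` gives `δ₀ X ≤ (1+δ₀) Y ≤ (1+δ₀) R₁`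
    have h1 : (1 + δ₀) * (X - Y) ≤ X := (le_div_iff₀ hD).1 hZmem.1
    rw [le_div_iff₀ hδ₀]
    nlinarith [hYmem.2]
  · -- `X/(X-Y) ≤ 1+R` gives `X ≤ (1+R)(X-Y)`, and `X > Y ≥ δ₁`
    have h1 : X ≤ (1 + R) * (X - Y) := (div_le_iff₀ hD).1 hZmem.2
    have hR : 0 < 1 + R := lt_of_lt_of_le (by linarith) (hZmem.1.trans hZmem.2)
    rw [div_le_iff₀ hR]
    nlinarith [hYmem.1]

end Facts

/-! ### The stopped ratio is an Itô process and `f(Z^ρ)` is a martingale -/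

section Main

/-- **The Itô drift of `f(Z)`, `Z = v/(v - u)`, along the two same-side flows `v = X`, `u = Y`**:
`𝓛f(v, u) = (2/(v-u)) (1/u + 1/v) f'(v/(v-u)) + (κ/2) (v-u)⁻² f''(v/(v-u))` (the SDE
`dZ = (2/(X-Y)²)(1/Z - 1/(1-Z)) dt - (√κ/(X-Y)) dB`). [cite: Lawler2005, Prop. 6.33] -/
def sameSideItoDrift (κ : ℝ≥0) (f : ℝ → ℝ) (v u : ℝ) : ℝ :=
  2 / (v - u) * (1 / u + 1 / v) * deriv f (v / (v - u)) +
    2⁻¹ * ((κ : ℝ) / (v - u) ^ 2) * iteratedDeriv 2 f (v / (v - u))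

/-- With Lawler's derivatives `f' = K`, `f'' = K (-2a/z + 2a/(1-z))`, `a = 2/κ`, the Itô drift
vanishes on `0 < u < v`: the hypergeometric equation (6.21) on the branch `z > 1`.
[cite: Lawler2005, Prop. 6.33] -/
theorem sameSideItoDrift_eq_zero (hκ : 0 < κ) {f K : ℝ → ℝ} {v u : ℝ} (hu : 0 < u) (huv : u < v)
    (hf1 : deriv f (v / (v - u)) = K (v / (v - u)))
    (hf2 : iteratedDeriv 2 f (v / (v - u)) =
      K (v / (v - u)) * (-(2 * (2 / (κ : ℝ))) / (v / (v - u)) + 2 * (2 / (κ : ℝ)) / (1 - v / (v - u)))) :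
    sameSideItoDrift κ f v u = 0 := by
  have hκ0 : (κ : ℝ) ≠ 0 := by exact_mod_cast hκ.ne'
  have hvne : v ≠ 0 := (hu.trans huv).ne'
  have hune : u ≠ 0 := hu.ne'
  have hdne : v - u ≠ 0 := by linarith
  have h1z : 1 - v / (v - u) = -u / (v - u) := by field_simp; ring
  simp only [sameSideItoDrift, hf1, hf2, h1z]
  field_simp
  ring

/-- **Itô's formula for a function of Lawler's ratio on the branch `Z > 1`, with the drift
kept.** Let `κ > 0`, `0 < y < x`, levels `0 < δ₀`, `1 + δ₀ < x/(x-y) < 1 + R`, `0 < δ₁ < y < R₁`,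
`ρ` the same-side stopping time and `f ∈ C²(ℝ)`. Then
`t ↦ f(Z_{t∧ρ}) - ∫₀^{t∧ρ} 𝓛f(X_s, Y_s) ds`, `Z = X/(X - Y)`, is a martingale of the raw Brownian
filtration, where `𝓛f(v, u) = (2/(v-u))(1/u + 1/v) f'(v/(v-u)) + (κ/2)(v-u)⁻² f''(v/(v-u))`
(`sameSideItoDrift`) is the Itô drift of `f(Z)`: the stopped flows are Itô processes
(`isItoProcess_stoppedProcess_sleRealFlowStop`), `1/(X - Y)` is a time integral
(`inv_eq_inv_add_timeIntegral`), the product rule (`IsItoProcess.mul_timeIntegral`) gives the SDE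
`dZ = (2/(X-Y)²)(1/Z - 1/(1-Z)) dt - (√κ/(X-Y)) dB`, and `martingale_apply_sub_timeIntegral`
applies. [cite: Lawler2005, Prop. 6.33] -/
theorem martingale_apply_sameSideRatio_sub_timeIntegral (hκ : 0 < κ) (hy : 0 < y) (hyx : y < x)
    {δ₀ R δ₁ R₁ : ℝ} (hδ₀ : 0 < δ₀) (hz₀ : 1 + δ₀ < x / (x - y)) (hz₀' : x / (x - y) < 1 + R)
    (hδ₁ : 0 < δ₁) (hδ₁y : δ₁ < y) (hyR₁ : y < R₁)
    {f : ℝ → ℝ} (hf : ContDiff ℝ 2 f) :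
    Martingale (fun t ω ↦ f (stoppedProcess (sleRealFlowStop κ x) (sleSameSideTime κ x y δ₀ R δ₁ R₁) t ω /
        (stoppedProcess (sleRealFlowStop κ x) (sleSameSideTime κ x y δ₀ R δ₁ R₁) t ω -
          stoppedProcess (sleRealFlowStop κ y) (sleSameSideTime κ x y δ₀ R δ₁ R₁) t ω)) -
        timeIntegral (trunc (sleSameSideTime κ x y δ₀ R δ₁ R₁) fun s ω ↦
          sameSideItoDrift κ f (sleRealFlowStop κ x s ω) (sleRealFlowStop κ y s ω)) t ω)
      brownianFiltration preWienerMeasure := by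
  haveI := isProbabilityMeasure_preWienerMeasure'
  have hx : 0 < x := hy.trans hyx
  have hxy : 0 < x - y := by linarith
  have hκ0 : (0 : ℝ) < κ := by exact_mod_cast hκ
  set ρ := sleSameSideTime κ x y δ₀ R δ₁ R₁ with hρdef
  have hρ : IsStoppingTime brownianFiltration ρ := isStoppingTime_sleSameSideTime hy hyx hδ₁ hδ₁y hyR₁ δ₀ R
  have hρ' : ∀ t : ℝ≥0, MeasurableSet[brownianFiltration t] {ω | ρ ω < t} :=
    fun t ↦ hρ.measurableSet_lt t
  have hbefore : ∀ (ω : ℝ≥0 → ℝ) (t : ℝ≥0), (t : WithTop ℝ≥0) ≤ ρ ω →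
      (t : WithTop ℝ≥0) < swallowingTime (sleDriving κ ω) y ∧
      δ₁ ≤ sleRealFlowStop κ y t ω ∧ sleRealFlowStop κ y t ω < sleRealFlowStop κ x t ω ∧
      sleRealFlowStop κ x t ω / (sleRealFlowStop κ x t ω - sleRealFlowStop κ y t ω) ∈ Icc (1 + δ₀) (1 + R) ∧
      sleRealFlowStop κ x t ω ≤ (1 + δ₀) * R₁ / δ₀ ∧
      δ₁ / (1 + R) ≤ sleRealFlowStop κ x t ω - sleRealFlowStop κ y t ω := fun ω t ht ↦
    sleSameSide_bounds_of_le (κ := κ) hy hyx hδ₀ hz₀ hz₀' hδ₁ hδ₁y hyR₁ ht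
  -- constants
  set Cx : ℝ := (1 + δ₀) * R₁ / δ₀ with hCx
  set d₀ : ℝ := δ₁ / (1 + R) with hd₀
  have hRpos : 0 < 1 + R := lt_trans (by linarith) (hz₀.trans hz₀')
  have hd₀pos : 0 < d₀ := div_pos hδ₁ hRpos
  -- the two frozen flows and their stopped versions
  set X := sleRealFlowStop κ x with hXdef
  set Y := sleRealFlowStop κ y with hYdef
  have hXc : ∀ ω, Continuous fun t ↦ X t ω := continuous_sleRealFlowStop hx.ne'
  have hYc : ∀ ω, Continuous fun t ↦ Y t ω := continuous_sleRealFlowStop hy.ne'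
  have hXprog := isStronglyProgressive_sleRealFlowStop κ hx.ne'
  have hYprog := isStronglyProgressive_sleRealFlowStop κ hy.ne'
  have hρX : ∀ ω (t : ℝ≥0), (t : WithTop ℝ≥0) ≤ ρ ω → X t ω ≠ 0 := fun ω t ht ↦ by
    have h := hbefore ω t ht
    exact (hδ₁.trans_le (h.2.1.trans h.2.2.1.le)).ne'
  have hρY : ∀ ω (t : ℝ≥0), (t : WithTop ℝ≥0) ≤ ρ ω → Y t ω ≠ 0 := fun ω t ht ↦
    (hδ₁.trans_le (hbefore ω t ht).2.1).ne'
  set V := stoppedProcess X ρ with hVdef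
  set U := stoppedProcess Y ρ with hUdef
  set σ' : ℝ≥0 → (ℝ≥0 → ℝ) → ℝ := trunc ρ fun _ _ ↦ -Real.sqrt κ with hσ'def
  have hV : IsItoProcess V (trunc ρ fun s ω ↦ 2 / V s ω) σ' brownian brownianFiltration
      preWienerMeasure := isItoProcess_stoppedProcess_sleRealFlowStop hx.ne' hρ hρX
  have hVa : StronglyAdapted brownianFiltration V := hXprog.stronglyAdapted_stoppedProcess hρ
  have hUa : StronglyAdapted brownianFiltration U := hYprog.stronglyAdapted_stoppedProcess hρ
  have hVc : ∀ ω, Continuous (V · ω) := fun ω ↦ continuous_stoppedProcess_path (hXc ω) ρ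
  have hUc : ∀ ω, Continuous (U · ω) := fun ω ↦ continuous_stoppedProcess_path (hYc ω) ρ
  have hVprog : IsStronglyProgressive brownianFiltration V := hVa.isStronglyProgressive_of_continuous hVc
  have hUprog : IsStronglyProgressive brownianFiltration U := hUa.isStronglyProgressive_of_continuous hUc
  have hσ' : IsStronglyProgressive brownianFiltration σ' :=
    isStronglyProgressive_trunc (isStronglyProgressive_const _ _) hρ'
  have hσ'bd : ∀ t ω, |σ' t ω| ≤ Real.sqrt κ := abs_trunc_neg_sqrt_le κ ρ
  -- the stopped clock and the bounds along the stopped paths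
  have hclock : ∀ ω (t : ℝ≥0), ((min (t : WithTop ℝ≥0) (ρ ω)).untopA : WithTop ℝ≥0) ≤ ρ ω :=
    fun ω t ↦ coe_untopA_min_le t (ρ ω)
  have hVU : ∀ ω t, δ₁ ≤ U t ω ∧ U t ω < V t ω ∧ V t ω / (V t ω - U t ω) ∈ Icc (1 + δ₀) (1 + R) ∧
      V t ω ≤ Cx ∧ d₀ ≤ V t ω - U t ω := by
    intro ω t
    have h := hbefore ω _ (hclock ω t)
    exact ⟨h.2.1, h.2.2.1, h.2.2.2.1, h.2.2.2.2.1, h.2.2.2.2.2⟩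
  have hVbd : ∀ t ω, |V t ω| ≤ Cx := fun t ω ↦ by
    obtain ⟨h1, h2, -, h4, -⟩ := hVU ω t
    rw [abs_of_pos (hδ₁.trans_le (h1.trans h2.le))]
    exact h4
  -- the gap in integrated form
  set Gp : ℝ≥0 → (ℝ≥0 → ℝ) → ℝ := fun s ω ↦ 2 / V s ω - 2 / U s ω with hGpdef
  have hgap : ∀ ω t, V t ω - U t ω = (x - y) + timeIntegral (trunc ρ Gp) t ω := by
    intro ω t
    set u : ℝ≥0 := (min (t : WithTop ℝ≥0) (ρ ω)).untopA with hu
    have hT := (hbefore ω u (hclock ω t)).1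
    have h1 := (sleRealFlowStop_sameSide_facts (κ := κ) hy hyx hT).2.2
    rw [timeIntegral_trunc]
    change X u ω - Y u ω = (x - y) + ∫ s in (0 : ℝ)..u, Gp s.toNNReal ω
    rw [h1]
    congr 1
    refine intervalIntegral.integral_congr fun s hs ↦ ?_
    rw [uIcc_of_le u.coe_nonneg] at hs
    have hsρ : (s.toNNReal : WithTop ℝ≥0) ≤ ρ ω :=
      (WithTop.coe_le_coe.2 (Real.toNNReal_le_iff_le_coe.2 hs.2)).trans (hclock ω t)
    simp only [hGpdef, hVdef, hUdef, stoppedProcess_eq_of_le hsρ, hXdef, hYdef]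
  -- the factor `A = 1/(V - U)` and its time derivative `a`
  set A : ℝ≥0 → (ℝ≥0 → ℝ) → ℝ := fun t ω ↦ (V t ω - U t ω)⁻¹ with hAdef
  set a : ℝ≥0 → (ℝ≥0 → ℝ) → ℝ := trunc ρ fun s ω ↦ -Gp s ω / (V s ω - U s ω) ^ 2 with hadef
  have hGpc : ∀ ω, Continuous fun s ↦ Gp s ω := fun ω ↦
    (continuous_const.div (hVc ω) fun s ↦ (hδ₁.trans_le ((hVU ω s).1.trans (hVU ω s).2.1.le)).ne').sub
      (continuous_const.div (hUc ω) fun s ↦ (hδ₁.trans_le (hVU ω s).1).ne')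
  have hArep : ∀ ω t, A t ω = A 0 ω + ∫ s in (0 : ℝ)..t, a s.toNNReal ω := by
    intro ω t
    have hpos : ∀ s, 0 < (x - y) + timeIntegral (trunc ρ Gp) s ω := fun s ↦ by
      rw [← hgap ω s]; linarith [(hVU ω s).2.1]
    have h := inv_eq_inv_add_timeIntegral (hGpc ω) hpos t
    have h0 : A 0 ω = (x - y)⁻¹ := by
      simp only [hAdef, hVdef, hUdef, stoppedProcess_eq_of_le (coe_zero_le_withTop _), hXdef, hYdef]
      rw [sleRealFlowStop_zero_apply hx.ne', sleRealFlowStop_zero_apply hy.ne']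
    have hfun : (trunc ρ fun s ω ↦ -Gp s ω / ((x - y) + timeIntegral (trunc ρ Gp) s ω) ^ 2) = a := by
      simp only [hadef]
      congr 1
      funext s ω
      rw [← hgap ω s]
    have hAt : A t ω = ((x - y) + timeIntegral (trunc ρ Gp) t ω)⁻¹ := by
      simp only [hAdef]; rw [hgap ω t]
    rw [hAt, h, h0, hfun]
    rfl
  have ha_int : ∀ ω (t : ℝ≥0), IntegrableOn (fun s : ℝ ↦ a s.toNNReal ω) (Icc 0 t) := by
    intro ω t
    refine integrableOn_trunc ?_
    have hc : Continuous fun s : ℝ ↦ -Gp s.toNNReal ω / (V s.toNNReal ω - U s.toNNReal ω) ^ 2 :=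
      ((hGpc ω).comp continuous_real_toNNReal).neg.div
        ((((hVc ω).sub (hUc ω)).comp continuous_real_toNNReal).pow 2)
        fun s ↦ (pow_pos (hd₀pos.trans_le (hVU ω _).2.2.2.2) 2).ne'
    exact hc.continuousOn.integrableOn_compact isCompact_Icc
  have hAbd : ∀ t ω, |A t ω| ≤ d₀⁻¹ := by
    intro t ω
    have hd := (hVU ω t).2.2.2.2
    simp only [hAdef]
    rw [abs_of_pos (inv_pos.2 (hd₀pos.trans_le hd))]
    exact inv_anti₀ hd₀pos hd
  have hAa : StronglyAdapted brownianFiltration A := fun t ↦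
    ((hVa t).measurable.sub (hUa t).measurable).inv.stronglyMeasurable
  have hAc : ∀ ω, Continuous (A · ω) := fun ω ↦
    ((hVc ω).sub (hUc ω)).inv₀ fun s ↦ (hd₀pos.trans_le (hVU ω s).2.2.2.2).ne'
  have hAprog : IsStronglyProgressive brownianFiltration A := hAa.isStronglyProgressive_of_continuous hAc
  -- the Itô integrals of `σ'V` and `σ'A`
  obtain ⟨KX, hKX, hKXM, -⟩ := exists_isItoIntegral_of_sq_integrable (hσ'.mul hVprog)
    (lintegral_lintegral_sq_ne_top_of_abs_le (C := fun _ ↦ Real.sqrt κ * Cx) fun t s ω _ ↦ by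
        rw [abs_mul]
        exact mul_le_mul (hσ'bd s ω) (hVbd s ω) (abs_nonneg _) (Real.sqrt_nonneg _))
  obtain ⟨KA, hKA, hKAM, -⟩ := exists_isItoIntegral_of_sq_integrable (hσ'.mul hAprog)
    (lintegral_lintegral_sq_ne_top_of_abs_le (C := fun _ ↦ Real.sqrt κ * d₀⁻¹) fun t s ω _ ↦ by
        rw [abs_mul]
        exact mul_le_mul (hσ'bd s ω) (hAbd s ω) (abs_nonneg _) (Real.sqrt_nonneg _))
  -- the product rule: `Z^ρ = V A` is an Itô process
  have hZ := IsItoProcess.mul_timeIntegral hVa hVc hσ' hV hAa hAc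
    (ae_of_all _ fun ω t ↦ hArep ω t) (ae_of_all _ fun ω t ↦ ha_int ω t) hKX hKXM hKA hKAM
  have hZmem : ∀ t ω, V t ω * A t ω ∈ Icc (1 + δ₀) (1 + R) := fun t ω ↦ by
    simp only [hAdef, ← div_eq_mul_inv]; exact (hVU ω t).2.2.1
  have hZa : StronglyAdapted brownianFiltration fun t ω ↦ V t ω * A t ω := fun t ↦ (hVa t).mul (hAa t)
  have hZc : ∀ ω, Continuous fun t ↦ V t ω * A t ω := fun ω ↦ (hVc ω).mul (hAc ω)
  have hZ0 : ∀ ω, V 0 ω * A 0 ω = x / (x - y) := fun ω ↦ by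
    simp only [hAdef, hVdef, hUdef, stoppedProcess_eq_of_le (coe_zero_le_withTop _), hXdef, hYdef,
      sleRealFlowStop_zero_apply hx.ne', sleRealFlowStop_zero_apply hy.ne', div_eq_mul_inv]
  -- progressivity of the coefficients of `Z^ρ`
  have hmeasφ : Measurable (Function.uncurry fun v u : ℝ ↦ -(2 / v - 2 / u) / (v - u) ^ 2) :=
    ((measurable_const.div measurable_fst).sub (measurable_const.div measurable_snd)).neg.div
      ((measurable_fst.sub measurable_snd).pow_const 2)
  have haprog : IsStronglyProgressive brownianFiltration a :=
    isStronglyProgressive_trunc (isStronglyProgressive_comp₂ hVprog hUprog hmeasφ) hρ'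
  have hbV : IsStronglyProgressive brownianFiltration (trunc ρ fun s ω ↦ 2 / V s ω) :=
    isStronglyProgressive_trunc (IsStronglyProgressive.comp_measurable₂ hVprog
      (F := fun _ v ↦ 2 / v) (measurable_const.div measurable_snd)) hρ'
  have hbZ : IsStronglyProgressive brownianFiltration
      fun t ω ↦ V t ω * a t ω + A t ω * trunc ρ (fun s ω ↦ 2 / V s ω) t ω :=
    (hVprog.mul haprog).add (hAprog.mul hbV)
  have hσZ : IsStronglyProgressive brownianFiltration fun t ω ↦ σ' t ω * A t ω := hσ'.mul hAprog
  have hσZbd : ∀ t ω, |σ' t ω * A t ω| ≤ Real.sqrt κ * d₀⁻¹ := fun t ω ↦ by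
    rw [abs_mul]; exact mul_le_mul (hσ'bd t ω) (hAbd t ω) (abs_nonneg _) (Real.sqrt_nonneg _)
  have hmart := martingale_apply_sub_timeIntegral hf hZa hZc hbZ hσZ hZ hZ0 hZmem hσZbd
  -- identify the Itô drift with `𝓛f(X, Y)` up to `ρ` (and `0` after)
  have hdriftEq : (fun s ω ↦ (V s ω * a s ω + A s ω * trunc ρ (fun s ω ↦ 2 / V s ω) s ω) *
      deriv f (V s ω * A s ω) + 2⁻¹ * (σ' s ω * A s ω) ^ 2 * iteratedDeriv 2 f (V s ω * A s ω)) =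
      trunc ρ fun s ω ↦ sameSideItoDrift κ f (X s ω) (Y s ω) := by
    funext s ω
    by_cases hs : (s : WithTop ℝ≥0) ≤ ρ ω
    · rw [trunc_of_le hs]
      simp only [hadef, hσ'def, hGpdef, trunc_of_le hs, hAdef, hVdef, hUdef, stoppedProcess_eq_of_le hs]
      obtain ⟨-, hu, huv, -, -, hd⟩ := hbefore ω s hs
      set v := X s ω
      set w := Y s ω
      have hvne : v ≠ 0 := (hδ₁.trans_le (hu.trans huv.le)).ne'
      have hwne : w ≠ 0 := (hδ₁.trans_le hu).ne'
      have hdne : v - w ≠ 0 := by linarith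
      simp only [sameSideItoDrift, div_eq_mul_inv]
      rw [mul_pow, neg_sq, Real.sq_sqrt κ.coe_nonneg]
      field_simp
      ring
    · rw [trunc_of_not_le hs]
      simp only [hadef, hσ'def, trunc_of_not_le hs]
      simp
  rw [hdriftEq] at hmart
  -- identify `V A` with the displayed ratio of stopped flows
  have heq : (fun t ω ↦ f (stoppedProcess (sleRealFlowStop κ x) ρ t ω /
      (stoppedProcess (sleRealFlowStop κ x) ρ t ω - stoppedProcess (sleRealFlowStop κ y) ρ t ω)) -
        timeIntegral (trunc ρ fun s ω ↦ sameSideItoDrift κ f (X s ω) (Y s ω)) t ω) =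
      fun t ω ↦ f (V t ω * A t ω) -
        timeIntegral (trunc ρ fun s ω ↦ sameSideItoDrift κ f (X s ω) (Y s ω)) t ω := by
    funext t ω
    simp only [hAdef, hVdef, hUdef, hXdef, hYdef, div_eq_mul_inv]
  rw [heq]
  exact hmart

/-- **Lawler's two-point martingale on the branch `Z > 1` (two points on the same side).** Let
`κ > 0`, `0 < y < x`, levels `0 < δ₀`, `1 + δ₀ < x/(x-y) < 1 + R`, `0 < δ₁ < y < R₁`, and `ρ` the
same-side stopping time. Let `f ∈ C²(ℝ)` have, on `[1 + δ₀, 1 + R]`, first derivative `K` and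
second derivative `K · (-2a/z + 2a/(1-z))` with `a = 2/κ` (the increasing solutions of (6.21) on
`z > 1`). Then `t ↦ f(Z_{t∧ρ})`, `Z = X/(X - Y)`, is a martingale of the raw Brownian filtration.
Proof: as `martingale_stoppedProcess_sleTwoPointObservable` — the stopped flows are Itô processes,
`1/(X - Y)` is a time integral, the product rule gives the SDE of `Z`, and the Itô drift of `f(Z)`
vanishes by `lawler_drift_identity`. [cite: Lawler2005, Prop. 6.33] -/
theorem martingale_apply_sameSideRatio_stopped (hκ : 0 < κ) (hy : 0 < y) (hyx : y < x)
    {δ₀ R δ₁ R₁ : ℝ} (hδ₀ : 0 < δ₀) (hz₀ : 1 + δ₀ < x / (x - y)) (hz₀' : x / (x - y) < 1 + R)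
    (hδ₁ : 0 < δ₁) (hδ₁y : δ₁ < y) (hyR₁ : y < R₁)
    {f : ℝ → ℝ} (hf : ContDiff ℝ 2 f) {K : ℝ → ℝ}
    (hf1 : ∀ z ∈ Icc (1 + δ₀) (1 + R), deriv f z = K z)
    (hf2 : ∀ z ∈ Icc (1 + δ₀) (1 + R),
      iteratedDeriv 2 f z = K z * (-(2 * (2 / (κ : ℝ))) / z + 2 * (2 / (κ : ℝ)) / (1 - z))) :
    Martingale (fun t ω ↦ f (stoppedProcess (sleRealFlowStop κ x) (sleSameSideTime κ x y δ₀ R δ₁ R₁) t ω /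
        (stoppedProcess (sleRealFlowStop κ x) (sleSameSideTime κ x y δ₀ R δ₁ R₁) t ω -
          stoppedProcess (sleRealFlowStop κ y) (sleSameSideTime κ x y δ₀ R δ₁ R₁) t ω)))
      brownianFiltration preWienerMeasure := by
  have hx : 0 < x := hy.trans hyx
  have h := martingale_apply_sameSideRatio_sub_timeIntegral (κ := κ) hκ hy hyx hδ₀ hz₀ hz₀' hδ₁ hδ₁y hyR₁ hf
  -- the drift vanishes up to `ρ` (and is truncated after)
  have hzero : (trunc (sleSameSideTime κ x y δ₀ R δ₁ R₁) fun s ω ↦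
      sameSideItoDrift κ f (sleRealFlowStop κ x s ω) (sleRealFlowStop κ y s ω)) = fun _ _ ↦ 0 := by
    funext s ω
    by_cases hs : (s : WithTop ℝ≥0) ≤ sleSameSideTime κ x y δ₀ R δ₁ R₁ ω
    · rw [trunc_of_le hs]
      obtain ⟨-, hu, huv, hz, -, -⟩ := sleSameSide_bounds_of_le (κ := κ) hy hyx hδ₀ hz₀ hz₀' hδ₁ hδ₁y hyR₁ hs
      exact sameSideItoDrift_eq_zero hκ (hδ₁.trans_le hu) huv (hf1 _ hz) (hf2 _ hz)
    · rw [trunc_of_not_le hs]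
  have hint : ∀ t ω, timeIntegral (trunc (sleSameSideTime κ x y δ₀ R δ₁ R₁) fun s ω ↦
      sameSideItoDrift κ f (sleRealFlowStop κ x s ω) (sleRealFlowStop κ y s ω)) t ω = 0 := by
    intro t ω
    rw [hzero]
    simp [timeIntegral]
  simpa only [hint, sub_zero] using h

end Main

end Literature.Probability.RandomPlanarGeometry
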